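import Summits.ResolutionOfSingularities.ResolutionOfSingularities.Theorems.PurelyInseparableDim4StepKitState
import HarnessLib

/-!
# Purely inseparable four-folds — BOUNDARY AMNESIA on zigzag branches of the coordinate frame: a kernel
# specimen (cell `res-dim4-pi`, frame caveat found under PR-1 (b))

[OURS · counted 0 · located fact about OUR coordinate frame; AI work, weaker than expert review]
Nothing here is a statement about resolution of singularities (NOT proved in dimension `≥ 4` /
characteristic `p` anywhere in this programme).

The frame's presented states `CentreBlowup.CState = (F, r, exc)` book the exceptional components
THROUGH THE CURRENT POINT: `CentreBlowup.step` at a point `b` with `b_i ≠ 0` (`i ∉ S`) drops the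
component `{x_i = 0}` from `r` and `exc` — correctly, the new point is off its strict transform, which
survives inside the new `F` as the unit factor `(x_i + b_i)^{ρ}`. But a LATER edge (with `i` outside every
centre in between) whose point has `x_i`-coordinate `−b_i` lands BACK ON that strict transform: the
polynomial is exact (`x_i^{ρ} ∣ F` again), while `r_i = 0` and `i ∉ exc` stay. The letter
`d = ord₀ F − |r|` of the frame then exceeds Hauser–Perlega's residual order (which factors out every
exceptional component through the point) by `ρ`; `NI`, `|E|`, `perm2` are read on the wrong boundary.
Over `𝔽₂` this is every branch translating the same off-centre variable by `1` twice.

The smallest MODE-1h specimen (`𝔽₂`, class `(4,1)`, `q = 2`), every check a `decide` through the STEP KIT: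
* `u = (x₀x₁x₂²x₃, r = (0,1,0,1), exc = {1,3})`;
* `u → s₁` is a MODE-1h edge (centre `{x₂}` = the 1h centre, `x₂`-chart, point `x₃ = 1`, equimultiple):
  `s₁ = (x₀x₁ + x₀x₁x₃, r = (0,1,0,0), exc = {1,2})` — `x₀x₁(1 + x₃)`, the factor `1 + x₃` being the
  strict transform of `E₃ = {x₃ = 0}`, correctly NOT through the point; shade `1`;
* `s₁ → s₂` is a MODE-1h edge (centre `{x₀,x₁}`, `x₁`-chart, point `x₃ = 1`, equimultiple):
  `s₂ = (x₀x₃, r = 0, exc = {1,2})`; the frame's shade is `2`: **`RiseD s₁ s₂`** (`1 → 2`)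
  (`step1h_u_s1`, `step1h_s1_s2`, `riseD_s1_s2`);
* but `x₃ ∣ F(s₂)` while `r₃(s₂) = 0`, `3 ∉ exc(s₂)` although `3 ∈ exc(u)` with `r₃(u) = 1` and `x₃` was
  moved by `1` at both edges and lies in neither centre (`amnesia`): here `{x₃ = 0}` IS the strict
  transform of `E₃` through the point, the true boundary is `r = (0,0,0,1)`, the true residual order is
  `ord₀(x₀) = 1 = shade(s₁)` — NO rise (`correctedShade_s2`).
What is NOT affected: `F`, condition (1), equimultiplicity, the centre choice — hence `Terminates1h`,
cycles, traps, the spine and isolated regimes; honest (valuation) branches never revisit a lost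
component, so the tree's Moh/HP theorems and all `t = 0` statistics stand. What IS affected: the
letters `d`, `NI`, `|E|`, `perm2` on edges downstream of a `t ≠ 0` edge, unless returning components are
re-booked.

bears_on: LADDER-RESOLUTION:D157-DOOR2 (res-dim4-pi · frame caveat / PR-1 (b)). Supports
stmt-ResolutionOfSingularities-16155 (helper).
-/

set_option linter.dupNamespace false

noncomputable section

open MvPolynomial Finset

open scoped BigOperators

namespace Summit.ResolutionOfSingularities.ResolutionOfSingularities.Theorems.PIDim4

open Literature.AlgebraicGeometry.Resolution
open Literature.AlgebraicGeometry.Resolution.Hauser2010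
open Literature.AlgebraicGeometry.Resolution.CentreBlowup

namespace MohAlong

namespace BoundaryAmnesia

open StepKit

/-! Presented states (written out in every statement; no definitions):
`u  = ⟨[x₀x₁x₂²x₃], r = (0,1,0,1), exc = {1,3}⟩`,
`s₁ = ⟨[x₀x₁, x₀x₁x₃], r = (0,1,0,0), exc = {1,2}⟩`,
`s₂ = ⟨[x₀x₃], r = (0,0,0,0), exc = {1,2}⟩`. -/

/-- **Edge 1 (MODE 1h)**: `u → s₁` along the 1h centre `{x₂}`, `x₂`-chart, at the point `x₃ = 1`
(the exceptional component `E₃` is translated away and dropped from the books). [folklore] -/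
theorem step1h_u_s1 :
    Step1h 2 (⟨[(![1, 1, 2, 1], 1)], ![0, 1, 0, 1], {1, 3}⟩ : SData 4 (ZMod 2)).toState
      (⟨[(![1, 1, 0, 0], 1), (![1, 1, 0, 1], 1)], ![0, 1, 0, 0], {1, 2}⟩ : SData 4 (ZMod 2)).toState :=
  step1h_of {2} 2 ![0, 0, 0, 1] (by decide) (by decide) rfl (by decide) (by decide) (by decide)

/-- **Edge 2 (MODE 1h)**: `s₁ → s₂` along the 1h centre `{x₀,x₁}`, `x₁`-chart, at the point `x₃ = 1`
(BACK onto the strict transform of `E₃`). [folklore] -/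
theorem step1h_s1_s2 :
    Step1h 2 (⟨[(![1, 1, 0, 0], 1), (![1, 1, 0, 1], 1)], ![0, 1, 0, 0], {1, 2}⟩ : SData 4 (ZMod 2)).toState
      (⟨[(![1, 0, 0, 1], 1)], ![0, 0, 0, 0], {1, 2}⟩ : SData 4 (ZMod 2)).toState :=
  step1h_of {0, 1} 1 ![0, 0, 0, 1] (by decide) (by decide) rfl (by decide) (by decide) (by decide)

/-- **The frame says RISE:d `1 → 2` on edge 2.** [folklore] -/
theorem riseD_s1_s2 :
    RiseD (⟨[(![1, 1, 0, 0], 1), (![1, 1, 0, 1], 1)], ![0, 1, 0, 0], {1, 2}⟩ : SData 4 (ZMod 2)).toState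
        (⟨[(![1, 0, 0, 1], 1)], ![0, 0, 0, 0], {1, 2}⟩ : SData 4 (ZMod 2)).toState ∧
      (⟨[(![1, 1, 0, 0], 1), (![1, 1, 0, 1], 1)], ![0, 1, 0, 0], {1, 2}⟩ : SData 4 (ZMod 2)).toState.shade
          = 1 ∧
      (⟨[(![1, 0, 0, 1], 1)], ![0, 0, 0, 0], {1, 2}⟩ : SData 4 (ZMod 2)).toState.shade = 2 :=
  ⟨(riseD_iff _ _).mpr (by decide), by rw [shade_toState]; decide, by rw [shade_toState]; decide⟩

/-- **The amnesia**: `x₃` is an exceptional component of `u` (`3 ∈ exc`, `r₃ = 1`), lies in neither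
centre (`3 ∉ {2}`, `3 ∉ {0,1}`), is moved by `1` at both edges (`x₃ = 1` twice: back to `E₃` over `𝔽₂`),
and at `s₂` the frame books `r₃ = 0`, `3 ∉ exc` although `x₃` DIVIDES `F(s₂) = x₀x₃`. [folklore] -/
theorem amnesia :
    (3 : Fin 4) ∈ (⟨[(![1, 1, 2, 1], 1)], ![0, 1, 0, 1], {1, 3}⟩ : SData 4 (ZMod 2)).toState.exc ∧
      (⟨[(![1, 1, 2, 1], 1)], ![0, 1, 0, 1], {1, 3}⟩ : SData 4 (ZMod 2)).toState.r 3 = 1 ∧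
      (3 : Fin 4) ∉ ({2} : Finset (Fin 4)) ∧ (3 : Fin 4) ∉ ({0, 1} : Finset (Fin 4)) ∧
      (![0, 0, 0, 1] : Fin 4 → ZMod 2) 3 + (![0, 0, 0, 1] : Fin 4 → ZMod 2) 3 = 0 ∧
      (⟨[(![1, 0, 0, 1], 1)], ![0, 0, 0, 0], {1, 2}⟩ : SData 4 (ZMod 2)).toState.r 3 = 0 ∧
      (3 : Fin 4) ∉ (⟨[(![1, 0, 0, 1], 1)], ![0, 0, 0, 0], {1, 2}⟩ : SData 4 (ZMod 2)).toState.exc ∧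
      ∀ d ∈ (⟨[(![1, 0, 0, 1], 1)], ![0, 0, 0, 0], {1, 2}⟩ : SData 4 (ZMod 2)).toState.F.support,
        1 ≤ d 3 := by
  refine ⟨by decide, by decide, by decide, by decide, by decide, by decide, by decide, fun d hd => ?_⟩
  rw [SData.toState_F, mem_support_evalT_iff] at hd
  have key : ∀ e ∈ live ([(![1, 0, 0, 1], (1 : ZMod 2))] : Terms 4 (ZMod 2)), 1 ≤ e 3 := by decide
  exact key _ hd

/-- **Re-booking the returning component kills the rise**: with `x₃` counted in the boundary
(multiplicity `ord_{x₃} F(s₂) = 1`), the residual order of `s₂` is `ord₀ F − |r| − 1 = 1 = shade(s₁)`: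
EQUAL, not RISE. [folklore] -/
theorem correctedShade_s2 :
    ordZero (⟨[(![1, 0, 0, 1], 1)], ![0, 0, 0, 0], {1, 2}⟩ : SData 4 (ZMod 2)).toState.F = 2 ∧
      ordZero (⟨[(![1, 0, 0, 1], 1)], ![0, 0, 0, 0], {1, 2}⟩ : SData 4 (ZMod 2)).toState.F -
          (((⟨[(![1, 0, 0, 1], 1)], ![0, 0, 0, 0], {1, 2}⟩ : SData 4 (ZMod 2)).toState.r.degree + 1 : ℕ) :
            ℕ∞) =
        (⟨[(![1, 1, 0, 0], 1), (![1, 1, 0, 1], 1)], ![0, 1, 0, 0], {1, 2}⟩ : SData 4 (ZMod 2)).toState.shade := by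
  refine ⟨by rw [SData.toState_F, ordZero_evalT]; decide, ?_⟩
  rw [SData.toState_F, ordZero_evalT, SData.toState_r, degree_expo, shade_toState]
  decide

/-- **Boundary amnesia, packaged.** Class `(4,1)`, `p = 2`: there is a MODE-1h branch `u → s₁ → s₂` of
the frame on which the frame's shade RISES at the second edge (`1 → 2`) although the rise is a
book-keeping artefact: an exceptional component of `u`, dropped at the first edge (translated away),
passes through the point of `s₂` again (`x₃ ∣ F(s₂)`) without being re-booked (`r₃ = 0`, `3 ∉ exc`), and
with it re-booked the residual order equals `shade(s₁)`. [folklore] -/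
theorem exists_step1h_riseD_boundaryAmnesia :
    ∃ u s₁ s₂ : State (ZMod 2), Step1h 2 u s₁ ∧ Step1h 2 s₁ s₂ ∧ RiseD s₁ s₂ ∧
      (3 : Fin 4) ∈ u.exc ∧ u.r 3 = 1 ∧ s₂.r 3 = 0 ∧ (3 : Fin 4) ∉ s₂.exc ∧
      (∀ d ∈ s₂.F.support, 1 ≤ d 3) ∧
      ordZero s₂.F - ((s₂.r.degree + 1 : ℕ) : ℕ∞) = s₁.shade := by
  obtain ⟨h1, h2, -, -, -, h6, h7, h8⟩ := amnesia
  exact ⟨_, _, _, step1h_u_s1, step1h_s1_s2, riseD_s1_s2.1, h1, h2, h6, h7, h8, correctedShade_s2.2⟩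

end BoundaryAmnesia

end MohAlong

end Summit.ResolutionOfSingularities.ResolutionOfSingularities.Theorems.PIDim4

end
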